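import Literature.NumberTheory.GaloisCohomology.Howard2004.GnTensorIdentificationProofs
import Literature.NumberTheory.GaloisCohomology.Howard2004.KolyvaginSystemScalars
import Literature.NumberTheory.GaloisCohomology.Howard2004.FiniteSingularTameAdmissible
import HarnessLib

/-!
# Howard 2004, display (ks relations) read on classes: «`loc_ℓ κ_n = 0 ⟺ loc_ℓ κ_{nℓ} = 0`»
# (the hypothesis `hKS` of the Lemma 1.6.4 induction)

Topic `NumberTheory/GaloisCohomology/Howard2004` (instantiation layer of Howard's Lemma 1.6.4 — the
residual Galois input of the print leaf G87 `Howard2004.thm161_dvrKolyvaginBound` = Thm. 1.6.1; cell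
`pub/bsd-print-x9`, seat `bsd-line-x10b-p1-w2` g15).  THEOREMS ONLY: no definition, no named fact, no
instance, no notation, no `sorry`.  Sequel to `GnTensorIdentificationProofs` (`a ↦ a ⊗ γ_n` is a
bijection `A ≅ A ⊗ G_n`), `KolyvaginSystemScalars` (`loc_λ (red κ_n)` is a finite class),
`FiniteSingularNatural` (`FsBijectiveAt`: the pinned slot is bijective on the finite classes) and
`SelmerTriples` §G (`LevelData.upperPath` / `lowerPath` / `IsKolyvaginSystem`).

Printed source.  B. Howard, *The Heegner point Kolyvagin system*, Compositio Math. **140** (2004)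
= arXiv:1202.6340, Def. 1.2.3 with display (ks relations) (arXiv p. 6 L126 – p. 7 L12: «for any
`nℓ ∈ 𝓝(𝓛)` the images of `κ_n` and `κ_{nℓ}` in `H¹_s(K_ℓ, T/I_{nℓ}T) ⊗ G_{nℓ}` under the maps
`H¹_{F(n)}(K,T/I_nT) ⊗ G_n → H¹_f(K_ℓ, T/I_{nℓ}T) ⊗ G_n —φ^{fs}_ℓ ⊗ 1→ H¹_s(K_ℓ,T/I_{nℓ}T) ⊗ G_{nℓ}`
and `H¹_{F(nℓ)}(K, T/I_{nℓ}T) ⊗ G_{nℓ} → H¹_s(K_ℓ, T/I_{nℓ}T) ⊗ G_{nℓ}` agree»), as USED in the proof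
of Lemma 1.6.4 (arXiv p. 12 L8–9: «By Proposition (induction), `loc_ℓ(κ^{(k)}(nℓ)) = 0`, but then
the Kolyvagin system relations imply that `loc_ℓ(κ_n^{(k)}) = 0`»; p. 12 L23–25: «`loc_ℓ(Stub(nℓ)) = 0`,
but the Kolyvagin system relations guarantee that `loc_ℓ(κ_{nℓ}) ≠ 0`» — since `loc_ℓ(κ_n) ≠ 0`).

What is here, in the tree's `LevelData` currency at ONE level (any `R`), with the classes
DE-TENSORED by the chosen generators `γ` (`κ_n = s_n ⊗ γ_n`, `κ_{nℓ} = s_{nℓ} ⊗ γ_{nℓ}`;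
`GnTensorIdentificationProofs.exists_unique_eq_tmul_tprod`):
* §1 `nsmul_galoisCohomology_one_eq_zero` — `N·M = 0 ⟹ N·H¹(F, M) = 0` (so the groups at a level
  `n ∋ λ` are killed by `#G_λ = ℓ + 1 ∈ I_λ ⊆ I_n`, `natCard_gell_smul_eq_zero_of_mem_level`);
  `upperPath_tmul`, `lowerPath_tmul_tprod` — the two paths of display (ks relations) on the
  de-tensored classes: `upper(s ⊗ γ_n) = φ^{fs}(loc_λ red s) ⊗ γ_n`,
  `lower(s' ⊗ γ_{nℓ}) = (loc^s_λ s' ⊗ γ_ℓ) ⊗ γ_n`.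
* §2 **`fs_localization_redH1_eq_of_isKolyvaginSystem`** — the relation de-tensored:
  `φ^{fs}_ℓ(loc_λ red s_n) = loc^s_λ(s_{nℓ}) ⊗ γ_ℓ` in `H¹_s(K_λ, T/I_{nℓ}T) ⊗ G_ℓ`.
* §3 **`localization_redH1_eq_zero_iff_of_isKolyvaginSystem`** — «`loc_λ κ_n = 0 ⟺ loc_λ κ_{nℓ} = 0`»
  (read at level `nℓ`): `loc_λ(red s_n) = 0 ↔ loc_λ(s_{nℓ}) = 0`, GIVEN that the slot is bijective on
  the finite classes at `(nℓ, λ)` (`FsBijectiveAt`, part of `IsFsAdmissible`) and that a Selmer class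
  of level `nℓ` unramified at `λ` is locally trivial at `λ` (`hdisj`: «`H¹_f ∩ H¹_tr = 0`», Prop.
  1.1.9 — a hypothesis here, the Galois side's); the two one-sided versions.
* §4 (append) the annihilation hypotheses `hA`/`hB`/`hS`/`hSv` DISCHARGED at `λ ∈ n ∈ 𝓝(𝓛)`:
  `natCard_gell_smul_galoisCohomology_eq_zero`, `…_selmerAt_…`, `…_localGaloisCohomology_…`,
  `…_singularQuotient_…` (lit's `natCard_gell_smul_eq_zero_of_mem_level` + §1).

HONEST FRAMING.  This is the reading of ONE Kolyvagin relation on elements; the hypothesis `hdisj`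
(Prop. 1.1.9 at a Kolyvagin prime) is an input (the annihilation hypotheses are discharged in §4);
Lemma 1.6.4 / Thm. 1.6.1 / `thm161_dvrKolyvaginBound` are NOT proved; no summit statement is proved;
the Birch–Swinnerton-Dyer conjecture is not proved by any of this.

References: [Howard2004HeegnerKolyvagin] Def. 1.2.3 with display (ks relations), Prop. 1.1.9,
Lemma 1.6.4 proof (arXiv p. 6 L126 – p. 7 L12; p. 5; p. 12 L8–9, L23–25);
[MazurRubinMemoirs2004] Def. 3.1.3 (the same relations for `R = ℤ_p`).
-/

set_option autoImplicit false

noncomputable section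

open Function Field NumberField IsDedekindDomain
open scoped Classical TensorProduct NumberField

namespace Literature.NumberTheory.GaloisCohomology.Howard2004

open Literature.NumberTheory.GaloisRepresentations
open Literature.NumberTheory.GaloisRepresentations.DiscreteGaloisModule

/-! ## §1 Annihilation of `H¹`; the two paths on de-tensored classes -/

section Annihilation

variable {F : Type} [Field F] {M : Type} [AddCommGroup M] [TopologicalSpace M] [DiscreteTopology M]

/-- **`N·M = 0 ⟹ N·H¹(F, M) = 0`** (the scalar `N ∈ ℤ` acts on `H¹` through `M`; tree
`galoisCohomology.smul_eq_zero_of_forall` at `R = ℤ`).  At a level `n ∋ λ` of a Kolyvagin system,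
`#G_λ = ℓ + 1 ∈ I_λ ⊆ I_n` kills `T/I_nT`, hence all its local and global `H¹`'s and their quotients.
[cite: Howard2004HeegnerKolyvagin, Def. 1.2.1 and Def. 1.2.3 (arXiv p. 6 L63–75, L126–131)] -/
theorem nsmul_galoisCohomology_one_eq_zero (ρ : DiscreteGaloisModule F M) {N : ℕ}
    (h : ∀ m : M, N • m = 0) (x : galoisCohomology ρ 1) : N • x = 0 := by
  have h1 := galoisCohomology.smul_eq_zero_of_forall ρ (isScalarLinear_int ρ) (N : ℤ)
    (fun m => by rw [natCast_zsmul, h m]) x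
  have h2 := galoisCohomology.intCast_smul_eq_zsmul ρ (isScalarLinear_int ρ) (N : ℤ) x
  rw [Int.cast_id] at h2
  rw [h2, natCast_zsmul] at h1
  exact h1

omit [TopologicalSpace M] [DiscreteTopology M] in
/-- `N·A = 0 ⟹ N·(A ⊗_ℤ G) = 0`. [folklore] -/
private theorem nsmul_tensor_eq_zero' {G : Type} [AddCommGroup G] {N : ℕ}
    (hA : ∀ a : M, N • a = 0) (x : M ⊗[ℤ] G) : N • x = 0 := by
  induction x using TensorProduct.induction_on with
  | zero => rw [smul_zero]
  | tmul a g => rw [TensorProduct.smul_tmul', hA, TensorProduct.zero_tmul]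
  | add x y hx hy => rw [smul_add, hx, hy, add_zero]

end Annihilation

namespace LevelData

variable {K : Type} [Field K] [NumberField K] {M : Type} [AddCommGroup M] [TopologicalSpace M]
  [DiscreteTopology M] {R : Type} [CommRing R] [Module R M]
  {p : ℕ} [Fact p.Prime] {ρ : DiscreteGaloisModule K M} {t : SelmerTriple p ρ}
  {N : Finset (HeightOneSpectrum (𝓞 K)) → Type} [∀ n, AddCommGroup (N n)]
  [∀ n, TopologicalSpace (N n)] [∀ n, DiscreteTopology (N n)] [∀ n, Module R (N n)]

/-- The upper path of display (ks relations) on a pure tensor: `upper(s ⊗ g) = φ^{fs}(loc_λ red s) ⊗ g`.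
[cite: Howard2004HeegnerKolyvagin, Def. 1.2.3, display (ks relations) (arXiv p. 6 L126–140)] -/
theorem upperPath_tmul (D : LevelData R ρ t N) (jbar : AlgebraicClosure K →+* ℂ)
    (n : Finset (HeightOneSpectrum (𝓞 K))) (v : HeightOneSpectrum (𝓞 K))
    (s : ↥(D.selmerAt jbar n)) (g : Gn (K := K) n) :
    D.upperPath jbar n v (s ⊗ₜ[ℤ] g) =
      D.fs (insert v n) v (galoisCohomology.localization (D.ρq (insert v n)) (Sum.inr v) 1
        (D.redH1 n v (s : galoisCohomology (D.ρq n) 1))) ⊗ₜ[ℤ] g := by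
  simp only [LevelData.upperPath, TensorProduct.map_tmul, LinearMap.id_apply]
  rfl

/-- The lower path of display (ks relations) on a de-tensored class:
`lower(s' ⊗ γ_{nℓ}) = (loc^s_λ s' ⊗ γ_ℓ) ⊗ γ_n`.
[cite: Howard2004HeegnerKolyvagin, Def. 1.2.3, display (ks relations) (arXiv p. 6 L126–140)] -/
theorem lowerPath_tmul_tprod (D : LevelData R ρ t N) (jbar : AlgebraicClosure K →+* ℂ)
    (n : Finset (HeightOneSpectrum (𝓞 K))) (v : HeightOneSpectrum (𝓞 K)) (h : v ∉ n)
    (γ : ∀ w : HeightOneSpectrum (𝓞 K), Gell w) (s' : ↥(D.selmerAt jbar (insert v n))) :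
    D.lowerPath jbar n v h (s' ⊗ₜ[ℤ] (PiTensorProduct.tprod ℤ fun q : ↥(insert v n) => γ q)) =
      (singularMap (GaloisRep.toLocal v (D.ρq (insert v n)))
          (galoisCohomology.localization (D.ρq (insert v n)) (Sum.inr v) 1
            (s' : galoisCohomology (D.ρq (insert v n)) 1)) ⊗ₜ[ℤ] γ v) ⊗ₜ[ℤ]
        (PiTensorProduct.tprod ℤ fun q : ↥n => γ q : Gn (K := K) n) := by
  simp only [LevelData.lowerPath, LinearMap.comp_apply, TensorProduct.map_tmul,
    LinearEquiv.coe_toLinearMap, gnInsertEquiv_tprod, TensorProduct.comm_tmul,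
    TensorProduct.assoc_symm_tmul]
  rfl

/-! ## §2 The relation at `(n, λ)` de-tensored -/

/-- **Display (ks relations) on de-tensored classes**: if `κ` satisfies the relations, `nℓ ∈ 𝓝(𝓛)`,
`κ_n = s_n ⊗ γ_n`, `κ_{nℓ} = s_{nℓ} ⊗ γ_{nℓ}` for the chosen generators, and `H¹_s(K_λ, T/I_{nℓ}T)` is
killed by the `#G_q`, `q ∣ n`, then `φ^{fs}_ℓ(loc_λ red s_n) = loc^s_λ(s_{nℓ}) ⊗ γ_ℓ` in
`H¹_s(K_λ, T/I_{nℓ}T) ⊗ G_ℓ`. [cite: Howard2004HeegnerKolyvagin, Def. 1.2.3, display (ks relations) (arXiv p. 6 L126 – p. 7 L12)] -/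
theorem fs_localization_redH1_eq_of_isKolyvaginSystem (D : LevelData R ρ t N)
    (jbar : AlgebraicClosure K →+* ℂ)
    {κ : ∀ n : Finset (HeightOneSpectrum (𝓞 K)), ↥(D.selmerAt jbar n) ⊗[ℤ] Gn (K := K) n}
    (hks : D.IsKolyvaginSystem jbar κ) (γ : ∀ w : HeightOneSpectrum (𝓞 K), Gell w)
    {n : Finset (HeightOneSpectrum (𝓞 K))} {v : HeightOneSpectrum (𝓞 K)} (hv : v ∉ n)
    (hnv : insert v n ∈ t.levelSet)
    (hγ : ∀ w ∈ n, ∀ x : Gell w, x ∈ AddSubgroup.zmultiples (γ w))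
    (hS : ∀ w ∈ n, ∀ y : SingularQuotient (GaloisRep.toLocal v (D.ρq (insert v n))),
      Nat.card (Gell w) • y = 0)
    {sn : ↥(D.selmerAt jbar n)} (hsn : κ n = sn ⊗ₜ[ℤ] (PiTensorProduct.tprod ℤ fun q : ↥n => γ q))
    {snv : ↥(D.selmerAt jbar (insert v n))}
    (hsnv : κ (insert v n) = snv ⊗ₜ[ℤ] (PiTensorProduct.tprod ℤ fun q : ↥(insert v n) => γ q)) :
    D.fs (insert v n) v (galoisCohomology.localization (D.ρq (insert v n)) (Sum.inr v) 1
        (D.redH1 n v (sn : galoisCohomology (D.ρq n) 1))) =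
      singularMap (GaloisRep.toLocal v (D.ρq (insert v n)))
          (galoisCohomology.localization (D.ρq (insert v n)) (Sum.inr v) 1
            (snv : galoisCohomology (D.ρq (insert v n)) 1)) ⊗ₜ[ℤ] γ v := by
  have hrel := hks n v hv hnv
  rw [hsn, hsnv, upperPath_tmul, lowerPath_tmul_tprod] at hrel
  exact (tmulRight_tprod_bijective γ n hγ (fun w hw b => nsmul_tensor_eq_zero' (hS w hw) b)).1 hrel

/-! ## §3 «`loc_λ κ_n = 0 ⟺ loc_λ κ_{nℓ} = 0`» -/

/-- **«the Kolyvagin system relations imply that `loc_ℓ(κ_n) = 0`»** (from `loc_ℓ(κ_{nℓ}) = 0`):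
under the hypotheses of `fs_localization_redH1_eq_of_isKolyvaginSystem`, if moreover `λ ∈ 𝓛`
and the slot is bijective on the finite classes at `(nℓ, λ)`, then `loc_λ(s_{nℓ}) = 0` implies
`loc_λ(red s_n) = 0` (the finite class `loc_λ red s_n` has `φ^{fs} = 0`).
[cite: Howard2004HeegnerKolyvagin, Lemma 1.6.4 proof, Case i (arXiv p. 12 L8–9)] -/
theorem localization_redH1_eq_zero_of_isKolyvaginSystem (D : LevelData R ρ t N)
    (jbar : AlgebraicClosure K →+* ℂ)
    {κ : ∀ n : Finset (HeightOneSpectrum (𝓞 K)), ↥(D.selmerAt jbar n) ⊗[ℤ] Gn (K := K) n}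
    (hks : D.IsKolyvaginSystem jbar κ) (γ : ∀ w : HeightOneSpectrum (𝓞 K), Gell w)
    {n : Finset (HeightOneSpectrum (𝓞 K))} {v : HeightOneSpectrum (𝓞 K)} (hv : v ∉ n)
    (hnv : insert v n ∈ t.levelSet) (hfs : D.FsBijectiveAt (insert v n) v)
    (hγ : ∀ w ∈ n, ∀ x : Gell w, x ∈ AddSubgroup.zmultiples (γ w))
    (hS : ∀ w ∈ n, ∀ y : SingularQuotient (GaloisRep.toLocal v (D.ρq (insert v n))),
      Nat.card (Gell w) • y = 0)
    {sn : ↥(D.selmerAt jbar n)} (hsn : κ n = sn ⊗ₜ[ℤ] (PiTensorProduct.tprod ℤ fun q : ↥n => γ q))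
    {snv : ↥(D.selmerAt jbar (insert v n))}
    (hsnv : κ (insert v n) = snv ⊗ₜ[ℤ] (PiTensorProduct.tprod ℤ fun q : ↥(insert v n) => γ q))
    (h0 : galoisCohomology.localization (D.ρq (insert v n)) (Sum.inr v) 1
      (snv : galoisCohomology (D.ρq (insert v n)) 1) = 0) :
    galoisCohomology.localization (D.ρq (insert v n)) (Sum.inr v) 1
      (D.redH1 n v (sn : galoisCohomology (D.ρq n) 1)) = 0 := by
  have hrel := fs_localization_redH1_eq_of_isKolyvaginSystem D jbar hks γ hv hnv hγ hS hsn hsnv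
  have hs0 : singularMap (GaloisRep.toLocal v (D.ρq (insert v n)))
      (galoisCohomology.localization (D.ρq (insert v n)) (Sum.inr v) 1
        (snv : galoisCohomology (D.ρq (insert v n)) 1)) = 0 := by
    rw [h0]; exact map_zero _
  rw [hs0, TensorProduct.zero_tmul] at hrel
  -- `loc_λ red s_n` is a finite class on which `φ^{fs}` is injective
  have hur := D.localization_redH1_mem_unramifiedSubgroup jbar hv
    (mem_primes_of_insert_mem_levelSet hnv) sn.2
  have hzero : (⟨_, hur⟩ : ↥(unramifiedSubgroup (GaloisRep.toLocal v (D.ρq (insert v n))) 1)) =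
      ⟨0, zero_mem _⟩ := by
    apply hfs.1
    change D.fs (insert v n) v _ = D.fs (insert v n) v 0
    rw [map_zero]
    exact hrel
  exact congrArg Subtype.val hzero

/-- **«the Kolyvagin system relations guarantee that `loc_ℓ(κ_{nℓ}) ≠ 0`»** (from `loc_ℓ(κ_n) ≠ 0`),
contrapositive form: if `loc_λ(red s_n) = 0` then `loc_λ(s_{nℓ}) = 0` — `loc^s_λ(s_{nℓ}) = 0` makes
`loc_λ s_{nℓ}` a finite class, and a level-`nℓ` Selmer class (transverse at `λ`) which is finite at
`λ` is locally zero there («`H¹_f ∩ H¹_tr = 0`», Prop. 1.1.9: the hypothesis `hdisj`).  Needs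
`#G_λ · H¹_s(K_λ, ·) = 0` as well (`hSv`).
[cite: Howard2004HeegnerKolyvagin, Lemma 1.6.4 proof, Case ii (arXiv p. 12 L23–25) with Prop. 1.1.9] -/
theorem localization_eq_zero_of_isKolyvaginSystem (D : LevelData R ρ t N)
    (jbar : AlgebraicClosure K →+* ℂ)
    {κ : ∀ n : Finset (HeightOneSpectrum (𝓞 K)), ↥(D.selmerAt jbar n) ⊗[ℤ] Gn (K := K) n}
    (hks : D.IsKolyvaginSystem jbar κ) (γ : ∀ w : HeightOneSpectrum (𝓞 K), Gell w)
    {n : Finset (HeightOneSpectrum (𝓞 K))} {v : HeightOneSpectrum (𝓞 K)} (hv : v ∉ n)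
    (hnv : insert v n ∈ t.levelSet)
    (hγ : ∀ w ∈ n, ∀ x : Gell w, x ∈ AddSubgroup.zmultiples (γ w))
    (hγv : ∀ x : Gell v, x ∈ AddSubgroup.zmultiples (γ v))
    (hS : ∀ w ∈ n, ∀ y : SingularQuotient (GaloisRep.toLocal v (D.ρq (insert v n))),
      Nat.card (Gell w) • y = 0)
    (hSv : ∀ y : SingularQuotient (GaloisRep.toLocal v (D.ρq (insert v n))),
      Nat.card (Gell v) • y = 0)
    (hdisj : ∀ y : ↥(D.selmerAt jbar (insert v n)),
      galoisCohomology.localization (D.ρq (insert v n)) (Sum.inr v) 1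
          (y : galoisCohomology (D.ρq (insert v n)) 1) ∈
        unramifiedSubgroup (GaloisRep.toLocal v (D.ρq (insert v n))) 1 →
      galoisCohomology.localization (D.ρq (insert v n)) (Sum.inr v) 1
        (y : galoisCohomology (D.ρq (insert v n)) 1) = 0)
    {sn : ↥(D.selmerAt jbar n)} (hsn : κ n = sn ⊗ₜ[ℤ] (PiTensorProduct.tprod ℤ fun q : ↥n => γ q))
    {snv : ↥(D.selmerAt jbar (insert v n))}
    (hsnv : κ (insert v n) = snv ⊗ₜ[ℤ] (PiTensorProduct.tprod ℤ fun q : ↥(insert v n) => γ q))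
    (h0 : galoisCohomology.localization (D.ρq (insert v n)) (Sum.inr v) 1
      (D.redH1 n v (sn : galoisCohomology (D.ρq n) 1)) = 0) :
    galoisCohomology.localization (D.ρq (insert v n)) (Sum.inr v) 1
      (snv : galoisCohomology (D.ρq (insert v n)) 1) = 0 := by
  haveI : Finite (𝓞 K ⧸ v.asIdeal) := v.asIdeal.finiteQuotientOfFreeOfNeBot v.ne_bot
  have hrel := fs_localization_redH1_eq_of_isKolyvaginSystem D jbar hks γ hv hnv hγ hS hsn hsnv
  rw [h0, map_zero] at hrel
  -- `loc^s_λ(s_{nℓ}) ⊗ γ_ℓ = 0 ⟹ loc^s_λ(s_{nℓ}) = 0`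
  have hsing : singularMap (GaloisRep.toLocal v (D.ρq (insert v n)))
      (galoisCohomology.localization (D.ρq (insert v n)) (Sum.inr v) 1
        (snv : galoisCohomology (D.ρq (insert v n)) 1)) = 0 := by
    apply (tmulRight_bijective (γ v) hγv hSv).1
    change _ = (0 : SingularQuotient (GaloisRep.toLocal v (D.ρq (insert v n)))) ⊗ₜ[ℤ] γ v
    rw [TensorProduct.zero_tmul]
    exact hrel.symm
  exact hdisj snv ((singularMap_eq_zero_iff _ _).mp hsing)

/-- **«`loc_λ κ_n = 0 ⟺ loc_λ κ_{nℓ} = 0`»** on the de-tensored classes — the hypothesis `hKS` of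
`StubLemmaInductionProofs.mem_stub_of_stubLemmaInduction`, read at level `nℓ`
(`loc n ℓ := loc_λ ∘ red_{n→nℓ}`, `loc (insert ℓ n) ℓ := loc_λ`).
[cite: Howard2004HeegnerKolyvagin, Def. 1.2.3 display (ks relations) and Lemma 1.6.4 proof (arXiv p. 6 L126 – p. 7 L12; p. 12 L8–9, L23–25)] -/
theorem localization_redH1_eq_zero_iff_of_isKolyvaginSystem (D : LevelData R ρ t N)
    (jbar : AlgebraicClosure K →+* ℂ)
    {κ : ∀ n : Finset (HeightOneSpectrum (𝓞 K)), ↥(D.selmerAt jbar n) ⊗[ℤ] Gn (K := K) n}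
    (hks : D.IsKolyvaginSystem jbar κ) (γ : ∀ w : HeightOneSpectrum (𝓞 K), Gell w)
    {n : Finset (HeightOneSpectrum (𝓞 K))} {v : HeightOneSpectrum (𝓞 K)} (hv : v ∉ n)
    (hnv : insert v n ∈ t.levelSet) (hfs : D.FsBijectiveAt (insert v n) v)
    (hγ : ∀ w ∈ n, ∀ x : Gell w, x ∈ AddSubgroup.zmultiples (γ w))
    (hγv : ∀ x : Gell v, x ∈ AddSubgroup.zmultiples (γ v))
    (hS : ∀ w ∈ n, ∀ y : SingularQuotient (GaloisRep.toLocal v (D.ρq (insert v n))),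
      Nat.card (Gell w) • y = 0)
    (hSv : ∀ y : SingularQuotient (GaloisRep.toLocal v (D.ρq (insert v n))),
      Nat.card (Gell v) • y = 0)
    (hdisj : ∀ y : ↥(D.selmerAt jbar (insert v n)),
      galoisCohomology.localization (D.ρq (insert v n)) (Sum.inr v) 1
          (y : galoisCohomology (D.ρq (insert v n)) 1) ∈
        unramifiedSubgroup (GaloisRep.toLocal v (D.ρq (insert v n))) 1 →
      galoisCohomology.localization (D.ρq (insert v n)) (Sum.inr v) 1
        (y : galoisCohomology (D.ρq (insert v n)) 1) = 0)
    {sn : ↥(D.selmerAt jbar n)} (hsn : κ n = sn ⊗ₜ[ℤ] (PiTensorProduct.tprod ℤ fun q : ↥n => γ q))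
    {snv : ↥(D.selmerAt jbar (insert v n))}
    (hsnv : κ (insert v n) = snv ⊗ₜ[ℤ] (PiTensorProduct.tprod ℤ fun q : ↥(insert v n) => γ q)) :
    galoisCohomology.localization (D.ρq (insert v n)) (Sum.inr v) 1
        (D.redH1 n v (sn : galoisCohomology (D.ρq n) 1)) = 0 ↔
      galoisCohomology.localization (D.ρq (insert v n)) (Sum.inr v) 1
        (snv : galoisCohomology (D.ρq (insert v n)) 1) = 0 :=
  ⟨localization_eq_zero_of_isKolyvaginSystem D jbar hks γ hv hnv hγ hγv hS hSv hdisj hsn hsnv,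
    localization_redH1_eq_zero_of_isKolyvaginSystem D jbar hks γ hv hnv hfs hγ hS hsn hsnv⟩

/-! ## §4 The annihilation hypotheses, discharged at a level `n ∈ 𝓝(𝓛)` -/

omit [Fact p.Prime] in
/-- **`#G_λ · H¹(K, T/I_nT) = 0` for `λ ∈ n ∈ 𝓝(𝓛)`** (`#G_λ = ℓ + 1 ∈ I_λ ⊆ I_n` kills `T/I_nT`, lit's
`natCard_gell_smul_eq_zero_of_mem_level`; then §1): the hypothesis `hA` of
`GnTensorIdentificationProofs.tmulRight_tprod_bijective` for the global `H¹`.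
[cite: Howard2004HeegnerKolyvagin, Def. 1.2.1 and Def. 1.2.3 (arXiv p. 6 L63–75, p. 7 L1–12)] -/
theorem natCard_gell_smul_galoisCohomology_eq_zero (D : LevelData R ρ t N)
    {n : Finset (HeightOneSpectrum (𝓞 K))} (hn : n ∈ t.levelSet) {v : HeightOneSpectrum (𝓞 K)}
    (hv : v ∈ n) (x : galoisCohomology (D.ρq n) 1) : Nat.card (Gell v) • x = 0 :=
  nsmul_galoisCohomology_one_eq_zero _ (natCard_gell_smul_eq_zero_of_mem_level D hn hv) x

/-- The same on the Selmer group `H¹_{F(n)}(K, T/I_nT)` (the group in which `κ_n` is de-tensored).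
[cite: Howard2004HeegnerKolyvagin, Def. 1.2.3 (arXiv p. 7 L1–12)] -/
theorem natCard_gell_smul_selmerAt_eq_zero (D : LevelData R ρ t N) (jbar : AlgebraicClosure K →+* ℂ)
    {n : Finset (HeightOneSpectrum (𝓞 K))} (hn : n ∈ t.levelSet) {v : HeightOneSpectrum (𝓞 K)}
    (hv : v ∈ n) (s : ↥(D.selmerAt jbar n)) : Nat.card (Gell v) • s = 0 :=
  Subtype.ext (by
    rw [AddSubgroupClass.coe_nsmul, ZeroMemClass.coe_zero]
    exact D.natCard_gell_smul_galoisCohomology_eq_zero hn hv s)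

omit [Fact p.Prime] in
/-- **`#G_λ · H¹(K_w, T/I_nT) = 0`** at every finite place `w` (the local groups; hypothesis `hB`).
[cite: Howard2004HeegnerKolyvagin, Def. 1.2.1 and Def. 1.2.3 (arXiv p. 6 L63–75, p. 7 L1–12)] -/
theorem natCard_gell_smul_localGaloisCohomology_eq_zero (D : LevelData R ρ t N)
    {n : Finset (HeightOneSpectrum (𝓞 K))} (hn : n ∈ t.levelSet) {v : HeightOneSpectrum (𝓞 K)}
    (hv : v ∈ n) (w : HeightOneSpectrum (𝓞 K))
    (y : galoisCohomology (GaloisRep.toLocal w (D.ρq n)) 1) : Nat.card (Gell v) • y = 0 :=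
  nsmul_galoisCohomology_one_eq_zero (GaloisRep.toLocal w (D.ρq n))
    (natCard_gell_smul_eq_zero_of_mem_level D hn hv) y

omit [Fact p.Prime] in
/-- **`#G_λ · H¹_s(K_w, T/I_nT) = 0`** (the singular quotients; hypotheses `hS`, `hSv` of §2–§3).
[cite: Howard2004HeegnerKolyvagin, Def. 1.2.1 and Def. 1.2.3 (arXiv p. 6 L63–75, p. 7 L1–12)] -/
theorem natCard_gell_smul_singularQuotient_eq_zero (D : LevelData R ρ t N)
    {n : Finset (HeightOneSpectrum (𝓞 K))} (hn : n ∈ t.levelSet) {v : HeightOneSpectrum (𝓞 K)}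
    (hv : v ∈ n) (w : HeightOneSpectrum (𝓞 K))
    (y : SingularQuotient (GaloisRep.toLocal w (D.ρq n))) : Nat.card (Gell v) • y = 0 := by
  obtain ⟨z, rfl⟩ := QuotientAddGroup.mk_surjective y
  rw [← QuotientAddGroup.mk_nsmul, D.natCard_gell_smul_localGaloisCohomology_eq_zero hn hv w z,
    QuotientAddGroup.mk_zero]

end LevelData

end Literature.NumberTheory.GaloisCohomology.Howard2004

end
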